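import Literature.AlgebraicGeometry.HodgeTheory.HodgeConjectureQbarVoisin
import Literature.AlgebraicGeometry.HodgeTheory.GysinFormalismCorrespondences
import Literature.AlgebraicGeometry.HodgeTheory.GlobalInvariantCycles
import Literature.AlgebraicGeometry.HodgeTheory.SupportedClassesRationalProofs
import Literature.AlgebraicGeometry.HodgeTheory.RationalClassesRingChange
import Literature.AlgebraicGeometry.HodgeTheory.HodgeStructureOfHodgeModel
import Literature.AlgebraicGeometry.Motives.HodgeStructureSemisimple
import HarnessLib

/-!
# Voisin (2007), Prop. 1.2 — proved bricks of the printed proof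

Companion (sorry-free, theorems only) of `HodgeConjectureQbarVoisin.lean`, which vendors
Voisin's Prop. 1.2 as the named facts `voisin2007_hodgeConjecture_absolute_of_qbar` /
`voisin2007_hodgeConjecture_weaklyAbsolute_of_qbar`.

The printed proof (C. Voisin, *Hodge loci and absolute Hodge classes*, Compositio Math. 143
(2007), §3, p. 6 of arXiv:math/0605766, read) runs: spread `(X, α)` out to a smooth projective
family `π : 𝒳 → T` over `ℚ̄` with a flat section `α̃` (using Lemma 2.4, hence Cattani–Deligne–Kaplan,
in the weakly absolute case); by Deligne's global invariant cycle theorem and a polarisation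
argument extend `α` to a (weakly) absolute Hodge class `β` on a smooth completion `𝒳̄` defined over
`ℚ̄`; apply the hypothesis to `(𝒳̄, β)`; and finally: *"`β` is the class of an algebraic cycle,
and then, so is its restriction `α`"* — restriction along `X = 𝒳_t ⊂ 𝒳 ⊂ 𝒳̄`.

Of these steps this file proves (i) the flat half of the last one, on the real carriers
`supportedClasses` / `algebraicClasses` (`AlgebraicClasses.lean`), (ii) the abstract core of the
polarisation argument, on the tree's `ℚ`-Hodge structures (`Motives.HodgeStructure`), (iii) the
passage from complex to RATIONAL coefficients in the global invariant cycle step (section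
`RationalLift`), and (iv) the assembly of (ii)–(iii) with the global invariant cycle theorem into
the HODGE lift *"`β ∈ Hdg²ᵏ(𝒳̄)` such that `β|_X = α`"* of the printed proof, relative to Hodge
structures on the rational cohomology of smooth projective varieties (section `HodgeLift`), plus
(v) the linear algebra of the weakly absolute case (section `WeaklyAbsoluteCase`):

* `map_mem_supportedClasses_of_flat` — pull-back along a FLAT `ℂ`-morphism of locally Noetherian
  `ℂ`-schemes preserves the support filtration `Nᶜ Hᵃ(–(ℂ); ℂ)`: a class vanishing off a closed
  `Z` of codimension `≥ c` pulls back to a class vanishing off `f⁻¹Z`, whose points have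
  codimension `≥ c` because codimension does not drop along flat morphisms
  (`coheight_base_le_of_flat`, Hartshorne III Prop. 9.5). This generalises the tree's
  `map_snd_mem_supportedClasses` (the projection `W ⊗ X → X`).
* `map_mem_algebraicClasses_of_flat`, `map_mem_algebraicClasses_of_isOpenImmersion` — the case
  `Nᵖ H²ᵖ`, in particular for the open immersion `𝒳 ⊂ 𝒳̄` of Voisin's proof (open immersions are
  flat; an open subscheme of a smooth projective variety is locally Noetherian).

* `Motives.HodgeStructure.Hom.map_hodgeClasses_eq_inf_range` and its companions (section
  `PolarisationArgument`) — the polarisation argument of the printed proof (p. 6: *"consider the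
  morphism of rational Hodge structures `H²ᵏ(𝒳̄, ℚ) → H²ᵏ(X, ℚ)` … there is an orthogonal
  decomposition `H²ᵏ(𝒳̄, ℚ) = A ⊕ B` … `B` is the kernel of the restriction map, `A` the orthogonal
  of `B` … We define then `β` to be the unique element of `A` which restricts to `α`"*), for an
  ARBITRARY morphism `φ : H′ → H` of `ℚ`-Hodge structures of weight `2p` with `H′` finite-dimensional
  and polarised by `Q` (the restriction map of the proof is not surjective, so the tree's
  `Hom.map_hodgeClasses_eq_of_surjective`, Voisin 2025 Cor. 2.12, does not apply as stated): every
  `h ∈ range φ` has a unique preimage in `A = (ker φ)^{⊥Q}`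
  (`Polarization.existsUnique_mem_orthogonal_ker_map_eq`), that preimage is a Hodge class when `h`
  is (`Polarization.mem_hodgeClasses_of_mem_orthogonal_ker`, from the finiteness-free
  `Hom.mem_hodgeClasses_of_mem_of_disjoint_ker`: a class in a sub-Hodge structure on which `φ` is
  injective is Hodge as soon as its image is), hence `φ(Hdgᵖ H′) = Hdgᵖ H ∩ range φ`.

* `exists_isRationalClass_map_eq_of_mem_span`, `exists_isRationalClass_map_eq`,
  `exists_isRationalClass_complexBetti_map_eq` — **rational descent of ranges**: a RATIONAL class
  lying in the image of `g^* : Hᵏ(Y(ℂ); ℂ) → Hᵏ(Y′(ℂ); ℂ)` is `g^*` of a rational class, for every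
  continuous `g : Y′ → Y` with `Hₖ(Y; ℚ)` finite-dimensional (e.g. `Y = 𝒳̄(ℂ)`, `𝒳̄` smooth
  projective): `range (g^* ⊗ ℂ) ∩ Hᵏ(Y′; ℚ) = range g^*`, from `Hᵏ(–; ℚ) ⊗ ℂ = Hᵏ(–; ℂ)` on both
  sides (`span_isRationalClass_eq_top`, `ringChange_mem_span_image_iff`); whence
  `deligne_globalInvariantCycles.exists_isRationalClass_eq_globalSection` — granted the tree's
  `ℂ`-coefficient global invariant cycle theorem, a RATIONAL invariant fibre class is the restriction
  of a RATIONAL class of the smooth compactification `𝒳̄` (the printed *"there exists a Hodge class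
  `β ∈ Hdg²ᵏ(𝒳̄)` … such that `β|_X = α`"* up to the Hodge condition, which is (ii)).
* `deligne_globalInvariantCycles.exists_hodgeClass_eq_globalSection_of_hodgeStructures`,
  `deligne_globalInvariantCycles.exists_hodgeClass_eq_globalSection` — **the Hodge lift**: granted
  `deligne_globalInvariantCycles` and Hodge structures on `H²ᵖ(𝒳̄(ℂ); ℚ)` (polarisable) and
  `H²ᵖ(𝒳_{s₀}(ℂ); ℚ)` whose Hodge classes are the rational classes of type `(p, p)` and for which
  restriction is a morphism (the inputs of `Motives.BettiHodgeData` on the tree's carriers, as in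
  `GysinHodgeClassLiftProofs`), a fibre class in the locus of Hodge classes extending to a
  continuous section is the restriction of a RATIONAL class of type `(p, p)` on `𝒳̄` — Voisin's
  *"there exists a Hodge class `β ∈ Hdg²ᵏ(𝒳̄)` such that `β|_X = α`"*, i.e. steps S2–S3 of the
  printed proof in full; and `….exists_hodgeClass_eq_globalSection_of_hodgeModels` /
  `…_of_exists_isReal_hodgeModel` (section `HodgeLiftOfModels`) — the same with the Hodge
  structures taken to be those of Hodge symmetric Hodge MODELS (`HodgeModel.hodgeStructure`,
  file `HodgeStructureOfHodgeModel`), which discharges the inputs `H`, `hHdg`, `hres` down to the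
  named facts `exists_isReal_hodgeModel`, `hodgePQ_independent_of_hodgeModel`; what then remains
  of S2–S3 is `deligne_globalInvariantCycles` and the polarisability of these Hodge structures
  (hard Lefschetz + Hodge–Riemann on the tree's carriers).
* `Motives.HodgeStructure.Polarization.exists_eq_smul_ofRat_of_mem_baseChange_orthogonal_ker`,
  `….exists_mem_hodgeClasses_eq_smul_ofRat` (section `WeaklyAbsoluteCase`) — the end of the
  printed proof in the weakly absolute case: `φ_ℂ` is injective on `A ⊗ ℂ`, so an element of
  `A ⊗ ℂ` restricting to `t • γ`, `γ` rational (Hodge), `t ≠ 0`, is `t • γ′` for the rational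
  (Hodge) lift `γ′ ∈ A` of `γ` (`β_σ = λ_σ γ′_σ`).

The global invariant cycle theorem is the tree's unproved named fact
`deligne_globalInvariantCycles` (`GlobalInvariantCycles.lean`); spreading out of a pair
(variety, class), the algebraicity of Hodge loci, the polarised Hodge structure on `H²ᵏ(𝒳̄(ℂ); ℚ)`
of a smooth projective `𝒳̄` as an object of `Motives.HodgeStructure`, and the functoriality of
`σ`-conjugation of classes are not in the tree, so
`voisin2007_hodgeConjecture_weaklyAbsolute_of_qbar_holds` is not proved here.

## References

* C. Voisin, *Hodge loci and absolute Hodge classes*, Compositio Math. 143 (2007) 945–958,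
  arXiv:math/0605766, §3 (proof of Prop. 1.2). [Voisin2007HodgeLoci]
* A. Grothendieck, *Hodge's general conjecture is false for trivial reasons*, Topology 8 (1969), §1
  (the filtration by codimension of support and its functoriality). [GrothendieckTopology1969]
* R. Hartshorne, *Algebraic Geometry* (1977), III Prop. 9.5 (dimension of fibres of a flat
  morphism). [Hartshorne1977]
* C. Voisin, *Hodge and generalized Hodge conjectures, coniveau and algebraic cycles*, J. Open
  Math. Probl. 1 (2025), Prop. 2.11, Cor. 2.12 (semisimplicity; lifting of Hodge classes). [Voisin2025]
* C. Voisin, *Hodge Theory and Complex Algebraic Geometry I* (2002), Lemma 7.26, §7.1.1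
  (`Hᵏ(X, ℚ) ⊗ ℂ = Hᵏ(X, ℂ)`). [VoisinHodgeI2002]
* A. Hatcher, *Algebraic Topology* (2002), §3.1, Thm. 3.2 and p. 198 (change of coefficients).
  [HatcherAT2002]
* F. Charles, C. Schnell, *Notes on absolute Hodge classes* (2014), Thm. 11.3.4, Prop. 11.3.5.
  [CharlesSchnell2014Notes]
-/

noncomputable section

open CategoryTheory AlgebraicGeometry

namespace Literature.AlgebraicGeometry.HodgeTheory

section HodgeTheory

variable {X' X : Motives.SchemeOver ℂ}

/-- **Flat pull-back respects the support filtration**: for a flat `ℂ`-morphism `f : X' ⟶ X` of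
locally Noetherian `ℂ`-schemes, `f^*(Nᶜ Hᵃ(X(ℂ); ℂ)) ⊆ Nᶜ Hᵃ(X'(ℂ); ℂ)` — a class vanishing on
`(X ∖ Z)(ℂ)`, `Z` Zariski-closed of codimension `≥ c`, pulls back to a class vanishing on
`(X' ∖ f⁻¹Z)(ℂ)`, and every point of `f⁻¹Z` has codimension `≥ c` since `codim x ≥ codim f(x)`
along a flat morphism. [cite: GrothendieckTopology1969, §1] [cite: Hartshorne1977, III Prop. 9.5] -/
theorem map_mem_supportedClasses_of_flat (f : X' ⟶ X) [Flat f.left] [IsLocallyNoetherian X'.left]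
    [IsLocallyNoetherian X.left] {a c : ℕ} {x : complexBetti X a}
    (hx : x ∈ supportedClasses X a c) :
    complexBetti.map f a x ∈ supportedClasses X' a c := by
  suffices h : supportedClasses X a c ≤
      (supportedClasses X' a c).comap (complexBetti.map f a).hom from h hx
  refine iSup_le fun S ↦ iSup_le fun hS ↦ iSup_le fun hc ↦ fun z hz ↦ ?_
  rw [LinearMap.mem_ker] at hz
  refine mem_supportedClasses_of_restrictCompl_eq_zero (hS.preimage f.left.base.hom.continuous)
    (fun w hw ↦ (hc _ hw).trans (coheight_base_le_of_flat f.left w)) ?_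
  exact complexBetti.restrictCompl_map_eq_zero f hz

/-- Submodule form of `map_mem_supportedClasses_of_flat`: `Nᶜ Hᵃ(X) ≤ (f^*)⁻¹ Nᶜ Hᵃ(X')` for `f`
flat. [cite: GrothendieckTopology1969, §1] -/
theorem supportedClasses_le_comap_map_of_flat (f : X' ⟶ X) [Flat f.left]
    [IsLocallyNoetherian X'.left] [IsLocallyNoetherian X.left] (a c : ℕ) :
    supportedClasses X a c ≤ (supportedClasses X' a c).comap (complexBetti.map f a).hom :=
  fun _ hx ↦ map_mem_supportedClasses_of_flat f hx

/-- **Flat pull-back preserves algebraic classes** (`Nᵖ H²ᵖ`): `f^*(algebraicClasses X p) ⊆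
algebraicClasses X' p` for `f : X' ⟶ X` flat between locally Noetherian `ℂ`-schemes — the flat case
of "`i^* cl(Z) = cl(i^* Z)`". [cite: GrothendieckTopology1969, §1] [cite: Hartshorne1977, III Prop. 9.5] -/
theorem map_mem_algebraicClasses_of_flat (f : X' ⟶ X) [Flat f.left] [IsLocallyNoetherian X'.left]
    [IsLocallyNoetherian X.left] {p : ℕ} {x : complexBetti X (2 * p)}
    (hx : x ∈ algebraicClasses X p) :
    complexBetti.map f (2 * p) x ∈ algebraicClasses X' p :=
  map_mem_supportedClasses_of_flat f hx

/-- The open-immersion half of the last step of Voisin's proof of Prop. 1.2 (*"`β` is the class of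
an algebraic cycle, and then, so is its restriction"*), for the open immersion `j : 𝒳 ⟶ 𝒳̄` into a
smooth projective completion: `j^*` maps `algebraicClasses 𝒳̄ p` into `algebraicClasses 𝒳 p`
(open immersions are flat; `𝒳̄` smooth projective is locally Noetherian, hence so is its open
subscheme `𝒳`). [cite: Voisin2007HodgeLoci, §3 (proof of Prop. 1.2)] [cite: GrothendieckTopology1969, §1] -/
theorem map_mem_algebraicClasses_of_isOpenImmersion {N : ℕ} {𝒳 Xbar : Motives.SchemeOver ℂ}
    (hXbar : Motives.IsSmoothProjective N Xbar) (j : 𝒳 ⟶ Xbar) [IsOpenImmersion j.left]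
    {p : ℕ} {β : complexBetti Xbar (2 * p)} (hβ : β ∈ algebraicClasses Xbar p) :
    complexBetti.map j (2 * p) β ∈ algebraicClasses 𝒳 p := by
  haveI : IsLocallyNoetherian Xbar.left := Motives.IsSmoothProjective.isLocallyNoetherian_holds hXbar
  haveI : IsLocallyNoetherian 𝒳.left := isLocallyNoetherian_of_isOpenImmersion j.left
  exact map_mem_algebraicClasses_of_flat j hβ

/-- The same for the whole support filtration: `j^*(Nᶜ Hᵃ(𝒳̄)) ⊆ Nᶜ Hᵃ(𝒳)` for an open immersion
`j : 𝒳 ⟶ 𝒳̄` into a smooth projective `𝒳̄`. [cite: GrothendieckTopology1969, §1] -/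
theorem map_mem_supportedClasses_of_isOpenImmersion {N : ℕ} {𝒳 Xbar : Motives.SchemeOver ℂ}
    (hXbar : Motives.IsSmoothProjective N Xbar) (j : 𝒳 ⟶ Xbar) [IsOpenImmersion j.left]
    {a c : ℕ} {β : complexBetti Xbar a} (hβ : β ∈ supportedClasses Xbar a c) :
    complexBetti.map j a β ∈ supportedClasses 𝒳 a c := by
  haveI : IsLocallyNoetherian Xbar.left := Motives.IsSmoothProjective.isLocallyNoetherian_holds hXbar
  haveI : IsLocallyNoetherian 𝒳.left := isLocallyNoetherian_of_isOpenImmersion j.left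
  exact map_mem_supportedClasses_of_flat j hβ

end HodgeTheory

/-! ### The polarisation argument of the printed proof (abstract core, on `ℚ`-Hodge structures)

Voisin, *loc. cit.* p. 6: the restriction `H²ᵏ(𝒳̄, ℚ) → H²ᵏ(X, ℚ)` is a morphism of rational Hodge
structures whose source is polarised by an ample line bundle; `B := ker`, `A := B^⊥`, and *"we
define then `β` to be the unique element of `A` which restricts to `α`"* — a Hodge class. Below,
`φ : H′ → H` is any morphism of `ℚ`-Hodge structures of weight `m = 2p` (`Motives.HodgeStructure.Hom`),
`Q` a polarisation of `H′` (`Motives.HodgeStructure.Polarization`), `Hdgᵖ = hodgeClasses p`. The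
declarations extend the tree's `Motives.HodgeStructure` API by dot-notation and are therefore
declared with their absolute names (CONVENTIONS §2). -/

section PolarisationArgument

open Motives.HodgeStructure
open scoped TensorProduct

universe u v

variable {V : Type u} [AddCommGroup V] [Module ℚ V] {V' : Type v} [AddCommGroup V'] [Module ℚ V']
  {m : ℤ}

/-- **A class on which `φ` is injective is Hodge as soon as its image is.** Let `φ : H′ → H` be a
morphism of `ℚ`-Hodge structures of weight `m = 2p`, `K ⊆ H′` a sub-Hodge structure with
`ker φ ∩ K = 0`, and `h′ ∈ K` with `φ h′ ∈ Hdgᵖ(H)`. Then `h′ ∈ Hdgᵖ(H′)`: writing `1 ⊗ h′ = Σ xᵢ`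
with `xᵢ ∈ K_ℂ ∩ V′^{i,m-i}` (a sub-Hodge structure is the sum of its Hodge components), the
`φ_ℂ xᵢ ∈ V^{i,m-i}` sum to `1 ⊗ φ h′ ∈ V^{p,p}`, so `φ_ℂ xᵢ = 0` for `i ≠ p`, hence `xᵢ = 0`
(`φ_ℂ` is injective on `K_ℂ`, `ℂ` being flat over `ℚ`) and `1 ⊗ h′ = x_p ∈ Fᵖ`. This is the
argument of Voisin 2025, Cor. 2.12, with the complement `K` of `ker φ` as a parameter and no
finiteness or polarisation hypothesis. [cite: Voisin2025, Cor. 2.12] [cite: Voisin2007HodgeLoci, §3 (proof of Prop. 1.2)] -/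
theorem _root_.Literature.AlgebraicGeometry.Motives.HodgeStructure.Hom.mem_hodgeClasses_of_mem_of_disjoint_ker
    {H' : Motives.HodgeStructure V' m} {H : Motives.HodgeStructure V m}
    (φ : Motives.HodgeStructure.Hom H' H) (K : Motives.HodgeStructure.SubHodgeStructure H')
    (hK : Disjoint (LinearMap.ker φ.toLinearMap) K.toSubmodule) {p : ℤ} (hp : p + p = m)
    {h' : V'} (hh'K : h' ∈ K.toSubmodule) (hh : φ.toLinearMap h' ∈ H.hodgeClasses p) :
    h' ∈ H'.hodgeClasses p := by
  set φc := φ.toLinearMap.baseChange ℂ with hφc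
  have hφc_ofRat : ∀ v : V', φc (ofRat v) = ofRat (φ.toLinearMap v) := fun v ↦ by
    rw [ofRat_apply, ofRat_apply, hφc, LinearMap.baseChange_tmul]
  rw [mem_hodgeClasses_iff]
  -- `φ_ℂ` is injective on `K_ℂ`
  have hinjK : ∀ x ∈ K.toSubmodule.baseChange ℂ, φc x = 0 → x = 0 := by
    rintro _ ⟨t, rfl⟩ ht
    have hinj : Function.Injective (φ.toLinearMap ∘ₗ K.toSubmodule.subtype) := by
      rw [← LinearMap.ker_eq_bot, LinearMap.ker_comp]
      exact Submodule.disjoint_iff_comap_eq_bot.1 hK.symm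
    have hcomp : φc (K.toSubmodule.subtype.baseChange ℂ t) =
        (φ.toLinearMap ∘ₗ K.toSubmodule.subtype).baseChange ℂ t := by
      rw [LinearMap.baseChange_comp]
      rfl
    rw [hcomp] at ht
    have ht0 : t = 0 := baseChange_injective_of_injective hinj (by rw [ht, map_zero])
    rw [ht0, map_zero]
  have hX : ofRat h' ∈ K.toSubmodule.baseChange ℂ := by
    rw [ofRat_apply]
    exact Submodule.tmul_mem_baseChange_of_mem 1 hh'K
  have hφX : φc (ofRat h') ∈ H.piece p (m - p) := by
    rw [hφc_ofRat, show m - p = p by omega]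
    exact ofRat_mem_piece_of_mem_hodgeClasses H hp hh
  obtain ⟨s, hs⟩ := Submodule.mem_iSup_iff_exists_finset.1 (K.baseChange_le_iSup_inf hX)
  suffices key : ∀ (s : Finset ℤ) (X : ℂ ⊗[ℚ] V'),
      X ∈ ⨆ i ∈ s, K.toSubmodule.baseChange ℂ ⊓ H'.piece i (m - i) →
        φc X ∈ H.piece p (m - p) → X ∈ H'.piece p (m - p) from
    piece_le_F H' p (m - p) (key s _ hs hφX)
  intro s
  induction s using Finset.induction_on with
  | empty =>
    intro X hX _
    simp only [Finset.notMem_empty, not_false_eq_true, iSup_neg, iSup_bot,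
      Submodule.mem_bot] at hX
    rw [hX]
    exact Submodule.zero_mem _
  | insert a s ha ih =>
    intro X hXs hφ
    rw [Finset.iSup_insert, Submodule.mem_sup] at hXs
    obtain ⟨z, ⟨hzK, hz⟩, w, hw, rfl⟩ := hXs
    have hφz : φc z ∈ H.piece a (m - a) := φ.map_piece_le _ _ ⟨z, hz, rfl⟩
    have hwle : (⨆ i ∈ s, K.toSubmodule.baseChange ℂ ⊓ H'.piece i (m - i)) ≤
        ⨆ i ∈ s, H'.piece i (m - i) := iSup₂_mono fun i _ ↦ inf_le_right
    have hwK : w ∈ K.toSubmodule.baseChange ℂ :=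
      (iSup₂_le fun i _ ↦ inf_le_left : (⨆ i ∈ s, K.toSubmodule.baseChange ℂ ⊓
        H'.piece i (m - i)) ≤ K.toSubmodule.baseChange ℂ) hw
    have hφw : φc w ∈ ⨆ i ∈ s, H.piece i (m - i) := φ.baseChange_mem_biSup_piece (hwle hw)
    by_cases hap : a = p
    · subst hap
      have hφw' : φc w ∈ H.piece a (m - a) := by
        have h := Submodule.sub_mem _ hφ hφz
        rwa [map_add, add_sub_cancel_left] at h
      have hw0 : w = 0 :=
        hinjK w hwK ((Submodule.disjoint_def.1 (disjoint_piece_biSup H ha)) _ hφw' hφw)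
      rw [hw0, add_zero]
      exact hz
    · have hz0 : φc z = 0 := by
        have hdisj : Disjoint (H.piece a (m - a)) (⨆ i ∈ insert p s, H.piece i (m - i)) :=
          disjoint_piece_biSup H (by simp [ha, hap])
        refine (Submodule.disjoint_def.1 hdisj) _ hφz ?_
        have h : φc z = φc (z + w) - φc w := by rw [map_add, add_sub_cancel_right]
        rw [h, Finset.iSup_insert]
        exact Submodule.sub_mem _ (Submodule.mem_sup_left hφ) (Submodule.mem_sup_right hφw)
      have hz' : z = 0 := hinjK z ⟨_, hzK.choose_spec⟩ hz0
      subst hz'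
      rw [zero_add] at hφ ⊢
      exact ih w hw hφ

/-- **Voisin's canonical lift** (*"`B` is the kernel of the restriction map, `A` is then defined as
the orthogonal of `B` under the metric … We define then `β` to be the unique element of `A` which
restricts to `α`"*): for `φ : H′ → H` a morphism of finite-dimensional-source `ℚ`-Hodge structures
and `Q` a polarisation of `H′`, every `h ∈ range φ` has exactly one preimage in
`A = (ker φ)^{⊥Q}` — because `ker φ` underlies a sub-Hodge structure, on which `Q` is
nondegenerate, so `V′ = ker φ ⊕ (ker φ)^{⊥Q}` (Voisin 2025, Prop. 2.11 / Voisin I, Lemma 7.26).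
[cite: Voisin2007HodgeLoci, §3 (proof of Prop. 1.2)] [cite: Voisin2025, Prop. 2.11] -/
theorem _root_.Literature.AlgebraicGeometry.Motives.HodgeStructure.Polarization.existsUnique_mem_orthogonal_ker_map_eq
    [Module.Finite ℚ V'] {H' : Motives.HodgeStructure V' m} {H : Motives.HodgeStructure V m}
    (Q : Motives.HodgeStructure.Polarization H') (φ : Motives.HodgeStructure.Hom H' H) {h : V}
    (hh : h ∈ LinearMap.range φ.toLinearMap) :
    ∃! h' : V', h' ∈ Q.form.orthogonal (LinearMap.ker φ.toLinearMap) ∧ φ.toLinearMap h' = h := by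
  obtain ⟨K₀, hK₀⟩ := φ.exists_subHodgeStructure_ker
  obtain ⟨K, hKorth, hcompl⟩ := K₀.exists_isCompl_eq_orthogonal Q
  rw [hK₀] at hcompl hKorth
  obtain ⟨v, rfl⟩ := hh
  have hv : v ∈ LinearMap.ker φ.toLinearMap ⊔ K.toSubmodule := by
    rw [hcompl.sup_eq_top]
    exact Submodule.mem_top
  obtain ⟨k, hk, k', hk', rfl⟩ := Submodule.mem_sup.1 hv
  have hφk : φ.toLinearMap (k + k') = φ.toLinearMap k' := by
    rw [map_add, LinearMap.mem_ker.1 hk, zero_add]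
  refine ⟨k', ⟨by rw [← hKorth]; exact hk', hφk.symm⟩, ?_⟩
  rintro y ⟨hy, hyk⟩
  rw [hφk] at hyk
  have hsub : y - k' ∈ LinearMap.ker φ.toLinearMap := by
    rw [LinearMap.mem_ker, map_sub, hyk, sub_self]
  have hsub' : y - k' ∈ K.toSubmodule := by
    rw [hKorth]
    exact Submodule.sub_mem _ hy (by rw [← hKorth]; exact hk')
  exact sub_eq_zero.1 ((Submodule.disjoint_def.1 hcompl.disjoint) _ hsub hsub')

/-- **The canonical lift of a Hodge class is a Hodge class**: with `φ : H′ → H` of weight `m = 2p`,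
`H′` finite-dimensional with polarisation `Q`, if `h′ ∈ (ker φ)^{⊥Q}` and `φ h′ ∈ Hdgᵖ(H)` then
`h′ ∈ Hdgᵖ(H′)` (`(ker φ)^{⊥Q}` underlies a sub-Hodge structure complementary to `ker φ`,
Prop. 2.11, and `Hom.mem_hodgeClasses_of_mem_of_disjoint_ker`). In Voisin's proof: `β ∈ A` with
`β|_X = α` Hodge is a Hodge class. [cite: Voisin2007HodgeLoci, §3 (proof of Prop. 1.2)] [cite: Voisin2025, Cor. 2.12] -/
theorem _root_.Literature.AlgebraicGeometry.Motives.HodgeStructure.Polarization.mem_hodgeClasses_of_mem_orthogonal_ker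
    [Module.Finite ℚ V'] {H' : Motives.HodgeStructure V' m} {H : Motives.HodgeStructure V m}
    (Q : Motives.HodgeStructure.Polarization H') (φ : Motives.HodgeStructure.Hom H' H) {p : ℤ}
    (hp : p + p = m) {h' : V'} (hh' : h' ∈ Q.form.orthogonal (LinearMap.ker φ.toLinearMap))
    (hh : φ.toLinearMap h' ∈ H.hodgeClasses p) : h' ∈ H'.hodgeClasses p := by
  obtain ⟨K₀, hK₀⟩ := φ.exists_subHodgeStructure_ker
  obtain ⟨K, hKorth, hcompl⟩ := K₀.exists_isCompl_eq_orthogonal Q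
  rw [hK₀] at hcompl hKorth
  exact φ.mem_hodgeClasses_of_mem_of_disjoint_ker K hcompl.disjoint hp (by rw [hKorth]; exact hh') hh

/-- **Hodge classes in the image of a morphism from a polarisable Hodge structure lift to Hodge
classes**: for `φ : H′ → H` a morphism of `ℚ`-Hodge structures of weight `m = 2p` with `H′`
finite-dimensional and polarisable, `φ(Hdgᵖ(H′)) = Hdgᵖ(H) ∩ range φ`. The inclusion `⊆` is
`φ_ℂ(Fᵖ) ⊆ Fᵖ`; `⊇` is the canonical lift in `(ker φ)^{⊥Q}`
(`Polarization.existsUnique_mem_orthogonal_ker_map_eq`,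
`Polarization.mem_hodgeClasses_of_mem_orthogonal_ker`). For `φ` surjective this is the tree's
`Hom.map_hodgeClasses_eq_of_surjective` (Voisin 2025, Cor. 2.12); the present form is the one used
in Voisin's proof of Prop. 1.2 (restriction to a fibre, not surjective) and in Charles–Schnell,
Prop. 11.3.5. [cite: Voisin2007HodgeLoci, §3 (proof of Prop. 1.2)] [cite: Voisin2025, Cor. 2.12] -/
theorem _root_.Literature.AlgebraicGeometry.Motives.HodgeStructure.Hom.map_hodgeClasses_eq_inf_range
    [Module.Finite ℚ V'] {H' : Motives.HodgeStructure V' m} {H : Motives.HodgeStructure V m}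
    (φ : Motives.HodgeStructure.Hom H' H) (hH' : H'.IsPolarizable) {p : ℤ} (hp : p + p = m) :
    (H'.hodgeClasses p).map φ.toLinearMap =
      H.hodgeClasses p ⊓ LinearMap.range φ.toLinearMap := by
  obtain ⟨Q⟩ := hH'
  apply le_antisymm
  · rintro _ ⟨h', hh', rfl⟩
    refine Submodule.mem_inf.2 ⟨?_, LinearMap.mem_range_self _ _⟩
    rw [SetLike.mem_coe, mem_hodgeClasses_iff] at hh'
    rw [mem_hodgeClasses_iff]
    have hc : φ.toLinearMap.baseChange ℂ (ofRat h') = ofRat (φ.toLinearMap h') := by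
      rw [ofRat_apply, ofRat_apply, LinearMap.baseChange_tmul]
    rw [← hc]
    exact φ.map_F_le p ⟨_, hh', rfl⟩
  · rintro h ⟨hh, hrange⟩
    obtain ⟨h', ⟨hh'o, rfl⟩, -⟩ := Q.existsUnique_mem_orthogonal_ker_map_eq φ hrange
    exact ⟨h', Q.mem_hodgeClasses_of_mem_orthogonal_ker φ hp hh'o hh, rfl⟩

/-- Elementwise form: a Hodge class `h ∈ Hdgᵖ(H)` lying in the image of `φ : H′ → H` (`H′`
finite-dimensional, polarisable) is the image of a Hodge class of `H′` — *"there exists a Hodge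
class `β ∈ Hdg²ᵏ(𝒳̄)` such that `β|_X = α`"* once `α` is known to extend to SOME class on `𝒳̄`
(the global invariant cycle theorem). [cite: Voisin2007HodgeLoci, §3 (proof of Prop. 1.2)] [cite: Voisin2025, Cor. 2.12] -/
theorem _root_.Literature.AlgebraicGeometry.Motives.HodgeStructure.Hom.exists_mem_hodgeClasses_eq_of_mem_range
    [Module.Finite ℚ V'] {H' : Motives.HodgeStructure V' m} {H : Motives.HodgeStructure V m}
    (φ : Motives.HodgeStructure.Hom H' H) (hH' : H'.IsPolarizable) {p : ℤ} (hp : p + p = m)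
    {h : V} (hh : h ∈ H.hodgeClasses p) (hrange : h ∈ LinearMap.range φ.toLinearMap) :
    ∃ h' ∈ H'.hodgeClasses p, φ.toLinearMap h' = h := by
  have hmem : h ∈ (H'.hodgeClasses p).map φ.toLinearMap := by
    rw [φ.map_hodgeClasses_eq_inf_range hH' hp]
    exact ⟨hh, hrange⟩
  exact hmem

end PolarisationArgument

/-! ### Rational lifts: the passage `ℚ ↝ ℂ` in the global invariant cycle step

Voisin, *loc. cit.* p. 6: *"The class `α` is rational and extends to a global section … By the
global invariant cycle theorem of Deligne, it follows that there exists a Hodge class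
`β ∈ Hdg²ᵏ(𝒳̄)`, such that `β|_X = α`"* — with `Hdg²ᵏ(𝒳̄) ⊆ H²ᵏ(𝒳̄, ℚ)`. The tree's
`deligne_globalInvariantCycles` is the `ℂ`-coefficient statement (a lift `A ∈ Hᵏ(𝒳̄(ℂ); ℂ)` of the
invariant class); the RATIONAL lift is recovered below by universal coefficients on both sides of
the restriction map: rational classes span `Hᵏ(𝒳̄(ℂ); ℂ)` (`span_isRationalClass_eq_top`, Hatcher
Thm. 3.2), and a rational class of the fibre lying in the complex span of the images of rational
classes lies in their rational span (`ringChange_mem_span_image_iff`, Voisin I §7.1.1) — i.e.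
`range (res ⊗ ℂ) ∩ Hᵏ(X; ℚ) = range res` for the `ℚ`-linear restriction `res`. -/

section RationalLift

open Literature.AlgebraicTopology.SingularHomology singularCochainComplex

universe u

variable {Y Y' : Type u} [TopologicalSpace Y] [TopologicalSpace Y'] {k : ℕ}

/-- Change of coefficients `ℚ → ℂ` commutes with pull-backs: `ι_{Y′}(g^* x) = g^*(ι_Y x)` for
`g : Y′ → Y` continuous (both are `u ↦ (ℚ ↪ ℂ) ∘ u ∘ g_♯` on cochains; Hatcher 2002, §3.1 p. 198).
This is `ringChange_map` of `GysinKernelWeights`, re-proved to keep the import cone of this file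
free of mixed Hodge structures. [cite: HatcherAT2002, §3.1 p. 198] -/
private theorem ringChange_rat_map_eq (g : C(Y', Y)) (x : singularCohomology ℚ ℚ Y k) :
    singularCohomology.ringChange (algebraMap ℚ ℂ) Y' k (singularCohomology.map ℚ ℚ g k x) =
      singularCohomology.map ℂ ℂ g k (singularCohomology.ringChange (algebraMap ℚ ℂ) Y k x) := by
  induction x using singularCohomology_induction_on with
  | h u =>
    rw [singularCohomology.map_π, singularCohomology.ringChange_π, singularCohomology.ringChange_π,
      singularCohomology.map_π]
    congr 1
    refine coFn_injective ?_
    rw [coFn_cocyclesRingChange, coFn_cocyclesMap, coFn_cocyclesMap, coFn_cocyclesRingChange]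
    funext σ
    rfl

/-- **Rational descent of ranges.** Let `g : Y′ → Y` be continuous and `c ∈ Hᵏ(Y; ℂ)` a complex
combination of rational classes (automatic when `Hₖ(Y; ℚ)` is finite-dimensional). If `g^* c` is a
RATIONAL class, then `g^* c = g^* c₀` for a RATIONAL class `c₀ ∈ Hᵏ(Y; ℂ)`: with
`ι = Hᵏ(–; ℚ) → Hᵏ(–; ℂ)` and `V = g^*(Hᵏ(Y; ℚ)) ⊆ Hᵏ(Y′; ℚ)`, the class `g^* c = ι_{Y′}(a)` lies in
`ℂ · ι_{Y′}(V)` (naturality of `ι`), hence `a ∈ V` by rational descent of linear relations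
(`ringChange_mem_span_image_iff`: `ℂ · ι(V) ∩ ι(Hᵏ(Y′; ℚ)) = ι(V)`), i.e.
`range (g^* ⊗ ℂ) ∩ Hᵏ(Y′; ℚ) = range g^*` (Voisin I, §7.1.1: `Hᵏ(–, ℚ) ⊗ ℂ = Hᵏ(–, ℂ)`).
[cite: VoisinHodgeI2002, §7.1.1] [cite: HatcherAT2002, §3.1 Thm. 3.2 and p. 198] -/
theorem exists_isRationalClass_map_eq_of_mem_span (g : C(Y', Y)) {c : singularCohomology ℂ ℂ Y k}
    (hc : c ∈ Submodule.span ℂ {a : singularCohomology ℂ ℂ Y k | IsRationalClass a})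
    (hgc : IsRationalClass (singularCohomology.map ℂ ℂ g k c)) :
    ∃ c₀ : singularCohomology ℂ ℂ Y k, IsRationalClass c₀ ∧
      singularCohomology.map ℂ ℂ g k c₀ = singularCohomology.map ℂ ℂ g k c := by
  set ιY := singularCohomology.ringChange (algebraMap ℚ ℂ) Y k with hιY
  set ιY' := singularCohomology.ringChange (algebraMap ℚ ℂ) Y' k with hιY'
  set V : Submodule ℚ (singularCohomology ℚ ℚ Y' k) :=
    LinearMap.range (singularCohomology.map ℚ ℚ g k).hom with hV
  obtain ⟨a, ha⟩ := hgc.exists_ringChange_eq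
  -- `g^* c ∈ ℂ · ι_{Y′}(V)`: `g^*` maps every rational class `ι_Y x` to `ι_{Y′}(g^* x)`
  have hle : Submodule.span ℂ {a : singularCohomology ℂ ℂ Y k | IsRationalClass a} ≤
      (Submodule.span ℂ (ιY' '' (V : Set (singularCohomology ℚ ℚ Y' k)))).comap
        (singularCohomology.map ℂ ℂ g k).hom := by
    rw [Submodule.span_le]
    intro b hb
    obtain ⟨x, rfl⟩ := IsRationalClass.exists_ringChange_eq hb
    change singularCohomology.map ℂ ℂ g k (ιY x) ∈
      Submodule.span ℂ (ιY' '' (V : Set (singularCohomology ℚ ℚ Y' k)))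
    rw [hιY, ← ringChange_rat_map_eq]
    exact Submodule.subset_span ⟨_, LinearMap.mem_range_self _ x, rfl⟩
  have hspan : ιY' a ∈ Submodule.span ℂ (ιY' '' (V : Set (singularCohomology ℚ ℚ Y' k))) := by
    rw [ha]
    exact hle hc
  obtain ⟨x₀, hx₀⟩ : a ∈ V := (ringChange_mem_span_image_iff V a).1 hspan
  refine ⟨ιY x₀, isRationalClass_ringChange x₀, ?_⟩
  rw [hιY, ← ringChange_rat_map_eq, ← ha]
  exact congrArg ιY' hx₀

/-- **Rational descent of ranges, finite-dimensional source**: for `g : Y′ → Y` continuous with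
`Hₖ(Y; ℚ)` finite-dimensional (so that rational classes span `Hᵏ(Y; ℂ)`,
`span_isRationalClass_eq_top`), every class `c ∈ Hᵏ(Y; ℂ)` whose pull-back `g^* c` is rational has
the same pull-back as some rational class `c₀`. [cite: VoisinHodgeI2002, §7.1.1]
[cite: HatcherAT2002, §3.1 Thm. 3.2 and p. 198] -/
theorem exists_isRationalClass_map_eq [Module.Finite ℚ (singularHomology ℚ ℚ Y k)] (g : C(Y', Y))
    (c : singularCohomology ℂ ℂ Y k) (hgc : IsRationalClass (singularCohomology.map ℂ ℂ g k c)) :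
    ∃ c₀ : singularCohomology ℂ ℂ Y k, IsRationalClass c₀ ∧
      singularCohomology.map ℂ ℂ g k c₀ = singularCohomology.map ℂ ℂ g k c :=
  exists_isRationalClass_map_eq_of_mem_span g
    (by rw [span_isRationalClass_eq_top k]; exact Submodule.mem_top) hgc

/-- **Rational descent of ranges for a `ℂ`-morphism into a smooth projective variety**: for
`φ : X′ ⟶ X` with `X` smooth projective (`Hₖ(X(ℂ); ℚ)` is finite-dimensional,
`finite_singularHomology_rat_complexPoints`) and `c ∈ Hᵏ(X(ℂ); ℂ)` with `φ^* c` rational, there is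
a rational `c₀ ∈ Hᵏ(X(ℂ); ℂ)` with `φ^* c₀ = φ^* c`. [cite: VoisinHodgeI2002, §7.1.1]
[cite: HatcherAT2002, §3.1 Thm. 3.2 and p. 198] -/
theorem exists_isRationalClass_complexBetti_map_eq {n : ℕ} {X' X : Motives.SchemeOver ℂ}
    (hX : Motives.IsSmoothProjective n X) (φ : X' ⟶ X) {k : ℕ} (c : complexBetti X k)
    (hc : IsRationalClass (complexBetti.map φ k c)) :
    ∃ c₀ : complexBetti X k, IsRationalClass c₀ ∧ complexBetti.map φ k c₀ = complexBetti.map φ k c := by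
  haveI := finite_singularHomology_rat_complexPoints hX k
  exact exists_isRationalClass_map_eq (Motives.AlgPoints.mapContinuous (L := ℂ) φ) c hc

/-- **The global invariant cycle theorem with rational coefficients, from the `ℂ`-coefficient one.**
Granted `deligne_globalInvariantCycles` (hard inclusion, `ℂ`-coefficients): for a smooth projective
family `f : 𝒳 ⟶ S` over a smooth quasi-projective `S`, an open immersion `i : 𝒳 ⟶ 𝒳̄` into a smooth
projective `𝒳̄`, a continuous section `σ` of `FiberClass.pt` (a global section of `Rᵏ f_* ℂ`) and a
point `s₀` at which the invariant class `σ(s₀)` is RATIONAL, there is a RATIONAL class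
`A ∈ Hᵏ(𝒳̄(ℂ); ℂ)` with `σ(s₀) = (s₀, A|_{𝒳_{s₀}})` — the printed `ℚ`-statement "`Hᵏ(𝒳₀, ℚ)^{π₁(S,0)}`
is the image of `i₀^* : Hᵏ(𝒳̄, ℚ) → Hᵏ(𝒳₀, ℚ)`" at a rational invariant class, and the coefficient
part of Voisin's *"there exists a Hodge class `β ∈ Hdg²ᵏ(𝒳̄)` such that `β|_X = α`"* (the Hodge part
being the polarisation argument, `Hom.map_hodgeClasses_eq_inf_range`). Proof: the complex lift `A`
of the fact and `exists_isRationalClass_complexBetti_map_eq` for `𝒳_{s₀} ⟶ 𝒳 ⟶ 𝒳̄`.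
[cite: Voisin2007HodgeLoci, §3 (proof of Prop. 1.2)] [cite: CharlesSchnell2014Notes, Theorem 11.3.4]
[cite: VoisinHodgeI2002, §7.1.1] -/
theorem deligne_globalInvariantCycles.exists_isRationalClass_eq_globalSection
    (h : deligne_globalInvariantCycles) {𝒳 Xbar S : Motives.SchemeOver ℂ} (f : 𝒳 ⟶ S)
    (i : 𝒳 ⟶ Xbar) {n m : ℕ} (hf : Motives.IsSmoothProjectiveFamily f n)
    (hS : IsQuasiProjectiveOver S) (hSs : Smooth S.hom) (hXbar : Motives.IsSmoothProjective m Xbar)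
    (hi : IsOpenImmersion i.left) {k : ℕ} {σ : Motives.ComplexPoints S → FiberClass f k}
    (hσ : Continuous σ) (hpt : ∀ s, (σ s).pt = s) {s₀ : Motives.ComplexPoints S}
    (hrat : IsRationalClass (σ s₀).cls) :
    ∃ A : complexBetti Xbar k, IsRationalClass A ∧
      σ s₀ = globalSection f k (complexBetti.map i k A) s₀ := by
  obtain ⟨A, hA⟩ := h 𝒳 Xbar S f i n m hf hS hSs hXbar.isProjectiveOver
    hXbar.smoothOfRelativeDimension hi k σ hσ hpt s₀
  rw [hA, cls_globalSection_map] at hrat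
  obtain ⟨A₀, hA₀, hA₀A⟩ :=
    exists_isRationalClass_complexBetti_map_eq hXbar (Motives.fiberι f s₀ ≫ i) A hrat
  refine ⟨A₀, hA₀, ?_⟩
  rw [hA]
  change (⟨s₀, complexBetti.map (Motives.fiberι f s₀) k (complexBetti.map i k A)⟩ : FiberClass f k) =
    ⟨s₀, complexBetti.map (Motives.fiberι f s₀) k (complexBetti.map i k A₀)⟩
  rw [← CategoryTheory.comp_apply, ← complexBetti.map_comp, ← CategoryTheory.comp_apply,
    ← complexBetti.map_comp, hA₀A]

end RationalLift

/-! ### The Hodge lift `β ∈ Hdg²ᵖ(𝒳̄)`, `β|_X = α`: steps S2–S3 of the printed proof, assembled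

Voisin, *loc. cit.* p. 6: *"Deligne's global invariant cycle theorem says now that for any smooth
completion `𝒳̄` of `𝒳`, there exists a Hodge class `β ∈ Hdg²ᵏ(𝒳̄)` such that `β|_X = α`. …
consider the morphism of rational Hodge structures `H²ᵏ(𝒳̄^an, ℚ) → H²ᵏ(X^an, ℚ)`. The left hand
side can be polarized using a ample line bundle `𝓛` on `𝒳̄`. … Thus we conclude that there is an
orthogonal decomposition `H²ᵏ(𝒳̄^an, ℚ) = A ⊕ B` into the sum of two Hodge structures, where the
first one identifies via restriction to its image in `H²ᵏ(X, ℚ)`, while the second one is the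
kernel of the restriction map. … We define then `β` to be the unique element of `A` which restricts
to `α`"* (in Charles–Schnell this Hodge lift is the semisimplicity step inside the proof of
Prop. 11.3.5). Below this is assembled ON THE TREE'S CARRIERS from the three bricks of this file —
the `ℂ`-coefficient global invariant cycle theorem (the named fact, hypothesis `h`), the rational
lift (`deligne_globalInvariantCycles.exists_isRationalClass_eq_globalSection`) and the
polarisation argument (`Hom.exists_mem_hodgeClasses_eq_of_mem_range`) — given the classical
Hodge-theoretic inputs in the idiom of `GysinHodgeClassLiftProofs` /
`Motives.BettiHodgeData`: Hodge structures on the rational cohomology `H²ᵖ(–(ℂ); ℚ)` of the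
smooth projective `𝒳̄` (polarisable: Voisin I, Thm. 6.32, §7.1.2) and of the fibre `X = 𝒳_{s₀}`,
whose Hodge classes are the rational classes of type `(p, p)` in the tree's sense
(`IsOfHodgeType`; Deligne 2000, §1), the restriction `H²ᵖ(𝒳̄(ℂ); ℚ) → H²ᵖ(X(ℂ); ℚ)` being a
morphism of Hodge structures (Voisin I, §7.3.2) — none of which is vendored as a named fact
(D-0026). -/

section HodgeLift

open Literature.AlgebraicTopology.SingularHomology Literature.AlgebraicGeometry.Motives

/-- **The Hodge lift, local form.** Granted `deligne_globalInvariantCycles`: let `f : 𝒳 ⟶ S` be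
a smooth projective family of relative dimension `n` over a smooth quasi-projective `S`,
`i : 𝒳 ⟶ 𝒳̄` an open immersion into a smooth projective `𝒳̄` of dimension `m`, `σ` a continuous
section of `FiberClass.pt` in degree `2p` whose value at `s₀` lies in the locus of Hodge classes
(`α = σ(s₀)` rational of type `(p, p)` on `X = 𝒳_{s₀}`). Suppose given Hodge structures `H_𝒳̄`
on `H²ᵖ(𝒳̄(ℂ); ℚ)` (polarisable, `hpol`) and `H_X` on `H²ᵖ(X(ℂ); ℚ)` of weight `2p`, such that
Hodge classes of `H_𝒳̄` are of type `(p, p)` (`hHXbar`), rational classes of type `(p, p)` on `X`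
are Hodge classes of `H_X` (`hHX`), and the restriction `(X ⟶ 𝒳 ⟶ 𝒳̄)^*` on `H²ᵖ(–(ℂ); ℚ)`
underlies a morphism `H_𝒳̄ → H_X` (`hres`). THEN *"there exists a Hodge class `β ∈ Hdg²ᵏ(𝒳̄)`
such that `β|_X = α`"*: a RATIONAL class `β ∈ H²ᵖ(𝒳̄(ℂ); ℂ)` of type `(p, p)` with
`σ(s₀) = (s₀, β|_{𝒳_{s₀}})`. Proof: a rational lift `ι(x₀)` exists
(`exists_isRationalClass_eq_globalSection`); its restriction `ι(res x₀) = α` is a Hodge class of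
`H_X`, so `res x₀ ∈ Hdgᵖ(H_X) ∩ range res = res (Hdgᵖ(H_𝒳̄))`
(`Hom.exists_mem_hodgeClasses_eq_of_mem_range`, the polarisation argument); take `β = ι(x₁)` for
a Hodge preimage `x₁`. [cite: Voisin2007HodgeLoci, §3 (proof of Prop. 1.2)]
[cite: CharlesSchnell2014Notes, Theorem 11.3.4 and Proposition 11.3.5]
[cite: VoisinHodgeI2002, §7.1.1, §7.1.2, Lemma 7.26 and §7.3.2] -/
theorem deligne_globalInvariantCycles.exists_hodgeClass_eq_globalSection_of_hodgeStructures
    (h : deligne_globalInvariantCycles) {𝒳 Xbar S : Motives.SchemeOver ℂ} (f : 𝒳 ⟶ S)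
    (i : 𝒳 ⟶ Xbar) {n m : ℕ} (hf : Motives.IsSmoothProjectiveFamily f n)
    (hS : IsQuasiProjectiveOver S) (hSs : Smooth S.hom) (hXbar : Motives.IsSmoothProjective m Xbar)
    (hi : IsOpenImmersion i.left) {p : ℕ} {σ : Motives.ComplexPoints S → FiberClass f (2 * p)}
    (hσ : Continuous σ) (hpt : ∀ s, (σ s).pt = s) {s₀ : Motives.ComplexPoints S}
    (h₀ : σ s₀ ∈ locusOfHodgeClasses f n p)
    (HXbar : HodgeStructure (singularCohomology ℚ ℚ (Motives.ComplexPoints Xbar) (2 * p))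
      ((2 * p : ℕ) : ℤ))
    (hpol : HXbar.IsPolarizable)
    (HX : HodgeStructure
      (singularCohomology ℚ ℚ (Motives.ComplexPoints (Motives.fiberOver f s₀)) (2 * p))
      ((2 * p : ℕ) : ℤ))
    (hHXbar : ∀ x : singularCohomology ℚ ℚ (Motives.ComplexPoints Xbar) (2 * p),
      x ∈ HXbar.hodgeClasses p → IsOfHodgeType m Xbar (2 * p) p p
        (singularCohomology.ringChange (algebraMap ℚ ℂ) (Motives.ComplexPoints Xbar) (2 * p) x))
    (hHX : ∀ y : singularCohomology ℚ ℚ (Motives.ComplexPoints (Motives.fiberOver f s₀)) (2 * p),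
      IsOfHodgeType n (Motives.fiberOver f s₀) (2 * p) p p
        (singularCohomology.ringChange (algebraMap ℚ ℂ)
          (Motives.ComplexPoints (Motives.fiberOver f s₀)) (2 * p) y) → y ∈ HX.hodgeClasses p)
    (hres : ∃ φ : HodgeStructure.Hom HXbar HX, φ.toLinearMap =
      (singularCohomology.map ℚ ℚ
        (Motives.AlgPoints.mapContinuous (L := ℂ) (Motives.fiberι f s₀ ≫ i)) (2 * p)).hom) :
    ∃ β : complexBetti Xbar (2 * p), IsRationalClass β ∧ IsOfHodgeType m Xbar (2 * p) p p β ∧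
      σ s₀ = globalSection f (2 * p) (complexBetti.map i (2 * p) β) s₀ := by
  obtain ⟨hrat₀, hhodge₀⟩ := (mem_locusOfHodgeClasses_iff _).1 h₀
  -- S2, `ℂ`- then `ℚ`-coefficients: a rational lift `A = ι(x₀)` of `α`
  obtain ⟨A, hA, hAσ⟩ :=
    h.exists_isRationalClass_eq_globalSection f i hf hS hSs hXbar hi hσ hpt hrat₀
  obtain ⟨x₀, rfl⟩ := hA.exists_ringChange_eq
  set ιXbar := singularCohomology.ringChange (algebraMap ℚ ℂ) (Motives.ComplexPoints Xbar) (2 * p)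
    with hιXbar
  set ιX := singularCohomology.ringChange (algebraMap ℚ ℂ)
    (Motives.ComplexPoints (Motives.fiberOver f s₀)) (2 * p) with hιX
  -- `α = A|_X` is of type `(p, p)`
  have hα : IsOfHodgeType n (Motives.fiberOver f s₀) (2 * p) p p
      (complexBetti.map (Motives.fiberι f s₀ ≫ i) (2 * p) (ιXbar x₀)) := by
    rw [hAσ, cls_globalSection_map] at hhodge₀
    exact hhodge₀
  -- S3: the restriction is a morphism of Hodge structures, `res x₀` is a Hodge class of `H_X`
  obtain ⟨φ, hφ⟩ := hres
  have hφx : ∀ x, ιX (φ.toLinearMap x) =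
      complexBetti.map (Motives.fiberι f s₀ ≫ i) (2 * p) (ιXbar x) := fun x ↦ by
    rw [hφ, hιX, hιXbar]
    exact ringChange_rat_map_eq _ x
  have ha : φ.toLinearMap x₀ ∈ HX.hodgeClasses p := hHX _ (by rw [hφx]; exact hα)
  -- the polarisation argument: a Hodge preimage `x₁` of `res x₀`
  haveI : Module.Finite ℚ (singularCohomology ℚ ℚ (Motives.ComplexPoints Xbar) (2 * p)) :=
    finite_singularCohomology_rat_complexPoints hXbar _
  obtain ⟨x₁, hx₁, hx₁eq⟩ := φ.exists_mem_hodgeClasses_eq_of_mem_range hpol (p := (p : ℤ))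
    (by push_cast; ring) ha (LinearMap.mem_range_self _ x₀)
  refine ⟨ιXbar x₁, isRationalClass_ringChange x₁, hHXbar x₁ hx₁, ?_⟩
  -- `β = ι(x₁)` restricts to `α`
  have key : complexBetti.map (Motives.fiberι f s₀ ≫ i) (2 * p) (ιXbar x₁) =
      complexBetti.map (Motives.fiberι f s₀ ≫ i) (2 * p) (ιXbar x₀) := by
    rw [← hφx, ← hφx, hx₁eq]
  rw [hAσ]
  change (⟨s₀, complexBetti.map (Motives.fiberι f s₀) (2 * p)
      (complexBetti.map i (2 * p) (ιXbar x₀))⟩ : FiberClass f (2 * p)) =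
    ⟨s₀, complexBetti.map (Motives.fiberι f s₀) (2 * p) (complexBetti.map i (2 * p) (ιXbar x₁))⟩
  rw [← CategoryTheory.comp_apply, ← complexBetti.map_comp, ← CategoryTheory.comp_apply,
    ← complexBetti.map_comp, key]

/-- **The Hodge lift from global Hodge data** (*"there exists a Hodge class `β ∈ Hdg²ᵏ(𝒳̄)` such
that `β|_X = α`"*, Voisin 2007 p. 6; the Hodge refinement of Charles–Schnell Thm. 11.3.4 used in
their Prop. 11.3.5). Let `H` assign to every smooth projective complex variety `X` of dimension
`n` and every `k` a Hodge structure of weight `k` on `Hᵏ(X(ℂ); ℚ)` (the Hodge decomposition,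
Voisin I §6.1.3, §7.1.1), polarisable (`hpol`: Lefschetz decomposition and Hodge–Riemann
relations, Voisin I Thm. 6.32, §7.1.2 — *"The left hand side can be polarized using a ample line
bundle `𝓛` on `𝒳̄`"*), whose Hodge classes are exactly the `x` with `ι(x)` of
type `(p, p)` in the tree's sense (`hHdg`; Deligne 2000, §1), and such that pull-back along every
morphism of smooth projective varieties underlies a morphism of Hodge structures (`hpull`;
Voisin I §7.3.2) — the shape of `Motives.BettiHodgeData` on the tree's carriers. Then, granted
`deligne_globalInvariantCycles`, for every smooth projective family `f : 𝒳 ⟶ S` over a smooth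
quasi-projective base with smooth projective completion `i : 𝒳 ⟶ 𝒳̄` and every continuous
section `σ` of fibre classes through a point `σ(s₀)` of the locus of Hodge classes, there is a
RATIONAL class `β` of type `(p, p)` on `𝒳̄` with `σ(s₀) = (s₀, β|_{𝒳_{s₀}})`. What this leaves of
steps S2–S3 of Voisin's proof is exactly `deligne_globalInvariantCycles` and the inputs
`H`/`hpol`/`hHdg`/`hpull`. [cite: Voisin2007HodgeLoci, §3 (proof of Prop. 1.2)]
[cite: CharlesSchnell2014Notes, Theorem 11.3.4 and Proposition 11.3.5]
[cite: VoisinHodgeI2002, §7.1.1, §7.1.2, Lemma 7.26 and §7.3.2] [cite: Deligne2000, §1] -/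
theorem deligne_globalInvariantCycles.exists_hodgeClass_eq_globalSection
    (h : deligne_globalInvariantCycles)
    (H : ∀ ⦃n : ℕ⦄ ⦃X : Motives.SchemeOver ℂ⦄, Motives.IsSmoothProjective n X → ∀ k : ℕ,
      HodgeStructure (singularCohomology ℚ ℚ (Motives.ComplexPoints X) k) (k : ℤ))
    (hpol : ∀ ⦃n : ℕ⦄ ⦃X : Motives.SchemeOver ℂ⦄ (hX : Motives.IsSmoothProjective n X) (k : ℕ),
      (H hX k).IsPolarizable)
    (hHdg : ∀ ⦃n : ℕ⦄ ⦃X : Motives.SchemeOver ℂ⦄ (hX : Motives.IsSmoothProjective n X) (p : ℕ)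
      (x : singularCohomology ℚ ℚ (Motives.ComplexPoints X) (2 * p)),
      x ∈ (H hX (2 * p)).hodgeClasses p ↔
        IsOfHodgeType n X (2 * p) p p
          (singularCohomology.ringChange (algebraMap ℚ ℂ) (Motives.ComplexPoints X) (2 * p) x))
    (hpull : ∀ ⦃n : ℕ⦄ ⦃X : Motives.SchemeOver ℂ⦄ (hX : Motives.IsSmoothProjective n X)
      ⦃m : ℕ⦄ ⦃Y : Motives.SchemeOver ℂ⦄ (hY : Motives.IsSmoothProjective m Y) (g : X ⟶ Y) (k : ℕ),
      ∃ φ : HodgeStructure.Hom (H hY k) (H hX k), φ.toLinearMap =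
        (singularCohomology.map ℚ ℚ (Motives.AlgPoints.mapContinuous (L := ℂ) g) k).hom)
    {𝒳 Xbar S : Motives.SchemeOver ℂ} (f : 𝒳 ⟶ S) (i : 𝒳 ⟶ Xbar) {n m : ℕ}
    (hf : Motives.IsSmoothProjectiveFamily f n) (hS : IsQuasiProjectiveOver S) (hSs : Smooth S.hom)
    (hXbar : Motives.IsSmoothProjective m Xbar) (hi : IsOpenImmersion i.left) {p : ℕ}
    {σ : Motives.ComplexPoints S → FiberClass f (2 * p)} (hσ : Continuous σ)
    (hpt : ∀ s, (σ s).pt = s) {s₀ : Motives.ComplexPoints S}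
    (h₀ : σ s₀ ∈ locusOfHodgeClasses f n p) :
    ∃ β : complexBetti Xbar (2 * p), IsRationalClass β ∧ IsOfHodgeType m Xbar (2 * p) p p β ∧
      σ s₀ = globalSection f (2 * p) (complexBetti.map i (2 * p) β) s₀ :=
  h.exists_hodgeClass_eq_globalSection_of_hodgeStructures f i hf hS hSs hXbar hi hσ hpt h₀
    (H hXbar (2 * p)) (hpol hXbar (2 * p)) (H (hf.isSmoothProjective s₀) (2 * p))
    (fun x hx ↦ (hHdg hXbar p x).1 hx) (fun y hy ↦ (hHdg (hf.isSmoothProjective s₀) p y).2 hy)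
    (hpull (hf.isSmoothProjective s₀) hXbar (Motives.fiberι f s₀ ≫ i) (2 * p))

end HodgeLift

/-! ### The weakly absolute case: an element of `A ⊗ ℂ` is determined by its restriction

Voisin, *loc. cit.* p. 6, end of the proof of Prop. 1.2: the horizontal maps of the diagram
`A ⊗ ℂ ↪ H²ᵏ(X, ℂ)`, `A_σ ⊗ ℂ ↪ H²ᵏ(X_σ, ℂ)` are injective, and *"It follows from this that if
`α` is absolute Hodge (resp. weakly absolute Hodge), so is `β`"* — in the weakly absolute case:
`β_σ ∈ A_σ ⊗ ℂ` restricts to `α_σ = λ_σ γ_σ` with `γ_σ` rational (Def. 2.1), so `γ_σ` lies in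
the rational image of `A_σ` and `β_σ = λ_σ γ′_σ` for its rational — hence Hodge — lift
`γ′_σ ∈ A_σ`. Abstractly, for `φ : H′ → H`, a polarisation `Q` of the finite-dimensional `H′` and
`A = (ker φ)^{⊥Q}` as in section `PolarisationArgument`: `φ_ℂ` is injective on `A ⊗ ℂ` (`ℂ` is
flat over `ℚ`), so an element of `A ⊗ ℂ` whose image is `t • (γ ⊗ 1)`, `γ` rational, `t ≠ 0`, is
`t • (γ′ ⊗ 1)` for the canonical lift `γ′ ∈ A` of `γ`, a Hodge class when `γ` is. -/

section WeaklyAbsoluteCase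

open Literature.AlgebraicGeometry.Motives Motives.HodgeStructure
open scoped TensorProduct

universe u v

variable {V : Type u} [AddCommGroup V] [Module ℚ V] {V' : Type v} [AddCommGroup V'] [Module ℚ V']
  {m : ℤ}

/-- **`φ_ℂ` is injective on `K ⊗ ℂ` when `ker φ ∩ K = 0`** (`ℂ` is flat over `ℚ`:
`(φ|_K)_ℂ = φ_ℂ|_{K_ℂ}` is injective with `φ|_K`). Finiteness-free.
[cite: VoisinHodgeI2002, §7.1.1] -/
theorem _root_.Literature.AlgebraicGeometry.Motives.HodgeStructure.Hom.eq_zero_of_mem_baseChange_of_disjoint_ker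
    {H' : Motives.HodgeStructure V' m} {H : Motives.HodgeStructure V m}
    (φ : Motives.HodgeStructure.Hom H' H) (K : Submodule ℚ V')
    (hK : Disjoint (LinearMap.ker φ.toLinearMap) K) {x : ℂ ⊗[ℚ] V'} (hx : x ∈ K.baseChange ℂ)
    (h0 : φ.toLinearMap.baseChange ℂ x = 0) : x = 0 := by
  obtain ⟨t, rfl⟩ := hx
  have hinj : Function.Injective (φ.toLinearMap ∘ₗ K.subtype) := by
    rw [← LinearMap.ker_eq_bot, LinearMap.ker_comp]
    exact Submodule.disjoint_iff_comap_eq_bot.1 hK.symm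
  have hcomp : φ.toLinearMap.baseChange ℂ (K.subtype.baseChange ℂ t) =
      (φ.toLinearMap ∘ₗ K.subtype).baseChange ℂ t := by
    rw [LinearMap.baseChange_comp]
    rfl
  rw [hcomp] at h0
  have ht0 : t = 0 := baseChange_injective_of_injective hinj (by rw [h0, map_zero])
  rw [ht0, map_zero]

/-- **Uniqueness in `A ⊗ ℂ`.** For `φ : H′ → H` with `H′` finite-dimensional and polarised by `Q`,
`A = (ker φ)^{⊥Q}`: if `x ∈ A ⊗ ℂ` and `γ′ ∈ A` have `φ_ℂ x = t • (φ γ′ ⊗ 1)`, then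
`x = t • (γ′ ⊗ 1)` — because `ker φ ⊕ A = V′` (Voisin I, Lemma 7.26 / Voisin 2025, Prop. 2.11)
makes `φ_ℂ` injective on `A ⊗ ℂ`. In Voisin's proof: `β_σ = λ_σ γ′_σ`.
[cite: Voisin2007HodgeLoci, §3 (proof of Prop. 1.2)] [cite: Voisin2025, Prop. 2.11] -/
theorem _root_.Literature.AlgebraicGeometry.Motives.HodgeStructure.Polarization.eq_smul_ofRat_of_mem_baseChange_orthogonal_ker
    [Module.Finite ℚ V'] {H' : Motives.HodgeStructure V' m} {H : Motives.HodgeStructure V m}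
    (Q : Motives.HodgeStructure.Polarization H') (φ : Motives.HodgeStructure.Hom H' H)
    {x : ℂ ⊗[ℚ] V'} (hx : x ∈ (Q.form.orthogonal (LinearMap.ker φ.toLinearMap)).baseChange ℂ)
    {t : ℂ} {γ' : V'} (hγ' : γ' ∈ Q.form.orthogonal (LinearMap.ker φ.toLinearMap))
    (hφx : φ.toLinearMap.baseChange ℂ x = t • ofRat (φ.toLinearMap γ')) :
    x = t • ofRat γ' := by
  obtain ⟨K₀, hK₀⟩ := φ.exists_subHodgeStructure_ker
  obtain ⟨K, hKorth, hcompl⟩ := K₀.exists_isCompl_eq_orthogonal Q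
  rw [hK₀] at hcompl hKorth
  have hdisj : Disjoint (LinearMap.ker φ.toLinearMap)
      (Q.form.orthogonal (LinearMap.ker φ.toLinearMap)) := by
    rw [← hKorth]
    exact hcompl.disjoint
  have hmem : x - t • ofRat γ' ∈ (Q.form.orthogonal (LinearMap.ker φ.toLinearMap)).baseChange ℂ :=
    Submodule.sub_mem _ hx (Submodule.smul_mem _ _ (by
      rw [ofRat_apply]; exact Submodule.tmul_mem_baseChange_of_mem 1 hγ'))
  have h0 : φ.toLinearMap.baseChange ℂ (x - t • ofRat γ') = 0 := by
    rw [map_sub, map_smul, hφx, ofRat_apply, ofRat_apply, LinearMap.baseChange_tmul, sub_self]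
  exact sub_eq_zero.1 (φ.eq_zero_of_mem_baseChange_of_disjoint_ker _ hdisj hmem h0)

/-- **An element of `A ⊗ ℂ` restricting to a non-zero complex multiple of a rational class is that
multiple of a rational element of `A`.** With `φ`, `Q`, `A = (ker φ)^{⊥Q}` as above, `x ∈ A ⊗ ℂ`,
`t ≠ 0` and `γ ∈ V` rational with `φ_ℂ x = t • (γ ⊗ 1)`: then `γ ∈ range φ` (rational descent:
`γ ⊗ 1 = t⁻¹ • φ_ℂ x ∈ (range φ)_ℂ` and `(I ⊗ ℂ) ∩ V = I`, `mem_of_ofRat_mem_baseChange`), and for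
the canonical lift `γ′ ∈ A` of `γ` (`Polarization.existsUnique_mem_orthogonal_ker_map_eq`) one has
`x = t • (γ′ ⊗ 1)`. This is the weakly absolute case of Voisin's proof: `α_σ = λ_σ γ_σ` forces
`β_σ = λ_σ γ′_σ`. [cite: Voisin2007HodgeLoci, §3 (proof of Prop. 1.2) and Def. 2.1]
[cite: Voisin2025, Prop. 2.11] -/
theorem _root_.Literature.AlgebraicGeometry.Motives.HodgeStructure.Polarization.exists_eq_smul_ofRat_of_mem_baseChange_orthogonal_ker
    [Module.Finite ℚ V'] {H' : Motives.HodgeStructure V' m} {H : Motives.HodgeStructure V m}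
    (Q : Motives.HodgeStructure.Polarization H') (φ : Motives.HodgeStructure.Hom H' H)
    {x : ℂ ⊗[ℚ] V'} (hx : x ∈ (Q.form.orthogonal (LinearMap.ker φ.toLinearMap)).baseChange ℂ)
    {t : ℂ} (ht : t ≠ 0) {γ : V} (hφx : φ.toLinearMap.baseChange ℂ x = t • ofRat γ) :
    ∃ γ' : V', γ' ∈ Q.form.orthogonal (LinearMap.ker φ.toLinearMap) ∧ φ.toLinearMap γ' = γ ∧
      x = t • ofRat γ' := by
  -- `γ ∈ range φ` by rational descent
  have hγc : ofRat γ ∈ (LinearMap.range φ.toLinearMap).baseChange ℂ := by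
    rw [LinearMap.range_eq_map, baseChange_map, Submodule.baseChange_top, Submodule.map_top]
    refine ⟨t⁻¹ • x, ?_⟩
    rw [map_smul, hφx, smul_smul, inv_mul_cancel₀ ht, one_smul]
  have hγ : γ ∈ LinearMap.range φ.toLinearMap := mem_of_ofRat_mem_baseChange _ hγc
  obtain ⟨γ', ⟨hγ'A, hφγ'⟩, -⟩ := Q.existsUnique_mem_orthogonal_ker_map_eq φ hγ
  refine ⟨γ', hγ'A, hφγ', Q.eq_smul_ofRat_of_mem_baseChange_orthogonal_ker φ hx hγ'A ?_⟩
  rw [hφγ']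
  exact hφx

/-- The same with the Hodge condition: if moreover the weight is `m = 2p` and `γ` is a Hodge
class of `H`, the rational element `γ′ ∈ A` with `x = t • (γ′ ⊗ 1)` is a Hodge class of `H′`
(`Polarization.mem_hodgeClasses_of_mem_orthogonal_ker`) — *"if `α` is … weakly absolute Hodge,
so is `β`"*: each conjugate `β_σ` is `λ_σ` times a rational Hodge class.
[cite: Voisin2007HodgeLoci, §3 (proof of Prop. 1.2) and Def. 2.1] [cite: Voisin2025, Cor. 2.12] -/
theorem _root_.Literature.AlgebraicGeometry.Motives.HodgeStructure.Polarization.exists_mem_hodgeClasses_eq_smul_ofRat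
    [Module.Finite ℚ V'] {H' : Motives.HodgeStructure V' m} {H : Motives.HodgeStructure V m}
    (Q : Motives.HodgeStructure.Polarization H') (φ : Motives.HodgeStructure.Hom H' H) {p : ℤ}
    (hp : p + p = m) {x : ℂ ⊗[ℚ] V'}
    (hx : x ∈ (Q.form.orthogonal (LinearMap.ker φ.toLinearMap)).baseChange ℂ) {t : ℂ} (ht : t ≠ 0)
    {γ : V} (hγ : γ ∈ H.hodgeClasses p) (hφx : φ.toLinearMap.baseChange ℂ x = t • ofRat γ) :
    ∃ γ' ∈ H'.hodgeClasses p, γ' ∈ Q.form.orthogonal (LinearMap.ker φ.toLinearMap) ∧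
      φ.toLinearMap γ' = γ ∧ x = t • ofRat γ' := by
  obtain ⟨γ', hγ'A, hφγ', hx'⟩ :=
    Q.exists_eq_smul_ofRat_of_mem_baseChange_orthogonal_ker φ hx ht hφx
  refine ⟨γ', Q.mem_hodgeClasses_of_mem_orthogonal_ker φ hp hγ'A ?_, hγ'A, hφγ', hx'⟩
  rw [hφγ']
  exact hγ

end WeaklyAbsoluteCase

/-! ### The Hodge lift from Hodge MODELS (inputs `H`/`hHdg`/`hres` supplied by `HodgeStructureOfHodgeModel`)

With `HodgeModel.hodgeStructure` (the `ℚ`-Hodge structure on `Hᵏ(X(ℂ); ℚ)` read through a Hodge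
symmetric Hodge model, file `HodgeStructureOfHodgeModel`), the Hodge-structure inputs of
`exists_hodgeClass_eq_globalSection_of_hodgeStructures` are instantiated: the compatibility with
`IsOfHodgeType` is `HodgeModel.mem_hodgeClasses_iff_isOfHodgeType_ringChange` and the restriction
morphism is `HodgeModel.hodgeStructureHom` (both granted `hodgePQ_independent_of_hodgeModel`);
symmetric models exist by `exists_isReal_hodgeModel`. What remains as input of steps S2–S3 is
`deligne_globalInvariantCycles` and the polarisability of the model's Hodge structure on
`H²ᵖ(𝒳̄(ℂ); ℚ)` (*"The left hand side can be polarized using a ample line bundle `𝓛` on `𝒳̄`"*: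
Lefschetz decomposition and Hodge–Riemann relations, not in the tree on these carriers). -/

section HodgeLiftOfModels

open Literature.AlgebraicTopology.SingularHomology Literature.AlgebraicGeometry.Motives

/-- **The Hodge lift, from Hodge models.** As
`deligne_globalInvariantCycles.exists_hodgeClass_eq_globalSection_of_hodgeStructures`, with the
Hodge structures on `H²ᵖ(𝒳̄(ℂ); ℚ)` and `H²ᵖ(𝒳_{s₀}(ℂ); ℚ)` those of Hodge symmetric Hodge models
`A` of `𝒳̄` and `B` of the fibre (`HodgeModel.hodgeStructure`): granted
`deligne_globalInvariantCycles`, `hodgePQ_independent_of_hodgeModel` and the polarisability of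
`A.hodgeStructure` in degree `2p`, a fibre class in the locus of Hodge classes extending to a
continuous section is the restriction of a RATIONAL class of type `(p, p)` on `𝒳̄` — *"there
exists a Hodge class `β ∈ Hdg²ᵏ(𝒳̄)` such that `β|_X = α`"*.
[cite: Voisin2007HodgeLoci, §3 (proof of Prop. 1.2)]
[cite: VoisinHodgeI2002, §7.1.1, §7.1.2, Lemma 7.26 and §7.3.2]
[cite: CharlesSchnell2014Notes, Theorem 11.3.4 and Proposition 11.3.5] -/
theorem deligne_globalInvariantCycles.exists_hodgeClass_eq_globalSection_of_hodgeModels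
    (h : deligne_globalInvariantCycles) (hI : hodgePQ_independent_of_hodgeModel)
    {𝒳 Xbar S : Motives.SchemeOver ℂ} (f : 𝒳 ⟶ S) (i : 𝒳 ⟶ Xbar) {n m : ℕ}
    (hf : Motives.IsSmoothProjectiveFamily f n) (hS : IsQuasiProjectiveOver S) (hSs : Smooth S.hom)
    (hXbar : Motives.IsSmoothProjective m Xbar) (hi : IsOpenImmersion i.left) {p : ℕ}
    {σ : Motives.ComplexPoints S → FiberClass f (2 * p)} (hσ : Continuous σ)
    (hpt : ∀ s, (σ s).pt = s) {s₀ : Motives.ComplexPoints S}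
    (h₀ : σ s₀ ∈ locusOfHodgeClasses f n p)
    (A : HodgeModel m Xbar) (hA : A.IsHodgeSymmetric)
    (B : HodgeModel n (Motives.fiberOver f s₀)) (hB : B.IsHodgeSymmetric)
    (hpol : (A.hodgeStructure hXbar hA (2 * p)).IsPolarizable) :
    ∃ β : complexBetti Xbar (2 * p), IsRationalClass β ∧ IsOfHodgeType m Xbar (2 * p) p p β ∧
      σ s₀ = globalSection f (2 * p) (complexBetti.map i (2 * p) β) s₀ :=
  h.exists_hodgeClass_eq_globalSection_of_hodgeStructures f i hf hS hSs hXbar hi hσ hpt h₀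
    (A.hodgeStructure hXbar hA (2 * p)) hpol
    (B.hodgeStructure (hf.isSmoothProjective s₀) hB (2 * p))
    (fun x hx ↦ (A.mem_hodgeClasses_iff_isOfHodgeType_ringChange hXbar hI hA p x).1 hx)
    (fun y hy ↦
      (B.mem_hodgeClasses_iff_isOfHodgeType_ringChange (hf.isSmoothProjective s₀) hI hB p y).2 hy)
    ⟨A.hodgeStructureHom hXbar hI hA B (hf.isSmoothProjective s₀) hB (Motives.fiberι f s₀ ≫ i)
      (2 * p), rfl⟩

/-- **The Hodge lift from the named facts** `deligne_globalInvariantCycles`,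
`exists_isReal_hodgeModel` (real, hence Hodge symmetric, models of `𝒳̄` and of the fibre) and
`hodgePQ_independent_of_hodgeModel`, plus the polarisability of the Hodge structures of Hodge
symmetric models of smooth projective varieties (`hpol`: hard Lefschetz and the Hodge–Riemann
relations, Voisin I Thm. 6.32 / §7.1.2 — the one input of steps S2–S3 of Voisin's proof that is
neither proved nor a named fact of the tree). [cite: Voisin2007HodgeLoci, §3 (proof of Prop. 1.2)]
[cite: VoisinHodgeI2002, §7.1.1, §7.1.2, Lemma 7.26 and §7.3.2] -/
theorem deligne_globalInvariantCycles.exists_hodgeClass_eq_globalSection_of_exists_isReal_hodgeModel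
    (h : deligne_globalInvariantCycles) (hR : exists_isReal_hodgeModel)
    (hI : hodgePQ_independent_of_hodgeModel)
    (hpol : ∀ ⦃m : ℕ⦄ ⦃Y : Motives.SchemeOver ℂ⦄ (hY : Motives.IsSmoothProjective m Y)
      (A : HodgeModel m Y) (hA : A.IsHodgeSymmetric) (k : ℕ), (A.hodgeStructure hY hA k).IsPolarizable)
    {𝒳 Xbar S : Motives.SchemeOver ℂ} (f : 𝒳 ⟶ S) (i : 𝒳 ⟶ Xbar) {n m : ℕ}
    (hf : Motives.IsSmoothProjectiveFamily f n) (hS : IsQuasiProjectiveOver S) (hSs : Smooth S.hom)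
    (hXbar : Motives.IsSmoothProjective m Xbar) (hi : IsOpenImmersion i.left) {p : ℕ}
    {σ : Motives.ComplexPoints S → FiberClass f (2 * p)} (hσ : Continuous σ)
    (hpt : ∀ s, (σ s).pt = s) {s₀ : Motives.ComplexPoints S}
    (h₀ : σ s₀ ∈ locusOfHodgeClasses f n p) :
    ∃ β : complexBetti Xbar (2 * p), IsRationalClass β ∧ IsOfHodgeType m Xbar (2 * p) p p β ∧
      σ s₀ = globalSection f (2 * p) (complexBetti.map i (2 * p) β) s₀ := by
  obtain ⟨A, hA⟩ := hR m Xbar hXbar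
  obtain ⟨B, hB⟩ := hR n (Motives.fiberOver f s₀) (hf.isSmoothProjective s₀)
  exact h.exists_hodgeClass_eq_globalSection_of_hodgeModels hI f i hf hS hSs hXbar hi hσ hpt h₀
    A hA.isHodgeSymmetric B hB.isHodgeSymmetric (hpol hXbar A hA.isHodgeSymmetric (2 * p))

end HodgeLiftOfModels

end Literature.AlgebraicGeometry.HodgeTheory

end
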